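import Mathlib
import Summits.PneNP.PneNP.Theorems.CnfIdealGenLengthRankDefectRepresentationsCutLemmaMaxCut

/-!
# Crux `RankDefectRepresentations` (stmt-PneNP-18923), line `rank-dehn-ladder`: ONE-SIDED DECOMPOSITION WITH SIGNED SLACK
# (lead g16 RESHAPE 13, tool stub W11 `stub_oneSidedSlack`; briefs `Cruxes/RankDefectRepresentations/Lines/rank-dehn-ladder-briefs-g16.md` §W11)

Setting: a matrix `R : Matrix ι ι' K` over a field whose rows and columns are coloured (`row : ι → Q`, `col : ι' → Q`), a set of
colours `B : Finset Q`, and the four blocks `Q = R|_{(row∈B)×(col∉B)}`, `S = R|_{(row∉B)×(col∈B)}`, `P = R|_{(row∈B)×(col∈B)}`;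
the BIPARTITION CUT of `R` at a colour set `X` is `μ(X) = rank R|_{X×Xᶜ} + rank R|_{Xᶜ×X}`.

g7's `…CutLemmaMaxCut.oneSided_decomposition` (p642504) proves: if `B` is maximal for `μ` against removing single colours
(`μ(B ∖ i) ≤ μ(B)` for every `i ∈ B`), then the diagonal super-block `P` is within rank `rank Q + (rank Q + rank S)` of a matrix
`P''` supported on `{row x = col y ∈ B}` (a colour-block-diagonal matrix).  Its proof uses maximality in exactly ONE place — the
per-colour bound `rank (P'_i − Q'_i Z_i) ≤ (rank Q − rank Q_{−i}) + (rank S − rank S_{−i})` — and the accounting there is an exact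
inequality in which `μ(B ∖ i) − μ(B)` enters additively.

THIS FILE (`oneSided_decomposition_slack`, and the registered signature `stub_oneSidedSlack` verbatim): the same statement with the
maximality hypothesis replaced by a SIGNED SLACK `δ : Q → ℤ` — `μ(B ∖ i) ≤ μ(B) + δ i` for `i ∈ B` (the `δ i` may be negative) — and
the total slack `Σ_{i∈B} δ i` added to the cost: `rank (P − P'') ≤ 2·rank Q + rank S + Σ_{i∈B} δ i` (over `ℤ`).  Proof = p642504's,
verbatim (same column-space lift `exists_lift`, same restriction `Z_i Δ_i` of the lift to the columns of colour `i`, same private-dimension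
count `sum_rank_sub_erase_le` for the rows of `Q` and the columns of `S`, same approximant `P''` and the same entrywise identity
`P − P'' = Q · (Σ_i Z_i Δ_i) + Σ_i E_i`), with `+ δ i` carried through the per-colour bound `ha` and the sum `hsumE`.  This is the input of
the LOCAL CUT INEQUALITY (W12, `stub_localCut`: Theorem 2 at an ARBITRARY cut with signed slack) and hence of the AVERAGE-CUT
DECOMPOSITION (W13).
HONEST FRAMING: elementary linear algebra, a negative-lane tool of the line; the crux stays open; P ≠ NP is not moved; F-N2 is a
FRONTIER formal rung.
-/

set_option linter.dupNamespace false -- `Summit.PneNP.PneNP.…`: summit = sub-problem name (D-0017)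

namespace Summit.PneNP.PneNP.Theorems.CnfIdealGenLengthRankDefectRepresentationsOneSidedSlack

open Finset Matrix Module
open Literature.Computability.AlgebraicComplexity (rank_add_le)
open Summit.PneNP.PneNP.Theorems.CnfIdealGenLengthRankDefectRepresentationsCutLemmaMaxCut
  (rank_finsetSum_le exists_lift sum_rank_sub_erase_le rank_rowZero_le)

variable {K : Type} [Field K]
variable {ι ι' Q : Type} [Fintype ι] [Fintype ι'] [DecidableEq ι] [DecidableEq ι'] [DecidableEq Q]

/-- **One-sided decomposition with signed slack.**  If for every colour `i ∈ B` the bipartition cut of `B ∖ {i}` is at most the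
bipartition cut of `B` plus a (signed) slack `δ i`, then the diagonal super-block `R|_{(row∈B)×(col∈B)}` is within rank
`2·rank R|_{(row∈B)×(col∉B)} + rank R|_{(row∉B)×(col∈B)} + Σ_{i∈B} δ i` of a colour-block-diagonal matrix supported on
`{row = col ∈ B}`.  (p642504's `oneSided_decomposition` is the case `δ = 0`.) [folklore] -/
theorem oneSided_decomposition_slack (row : ι → Q) (col : ι' → Q) (R : Matrix ι ι' K) (B : Finset Q) (δ : Q → ℤ)
    (h : ∀ i ∈ B,
      (((Matrix.of fun x y => if row x ∈ B.erase i ∧ col y ∉ B.erase i then R x y else 0).rank : ℤ) +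
        ((Matrix.of fun x y => if row x ∉ B.erase i ∧ col y ∈ B.erase i then R x y else 0).rank : ℤ)) ≤
      ((Matrix.of fun x y => if row x ∈ B ∧ col y ∉ B then R x y else 0).rank : ℤ) +
        ((Matrix.of fun x y => if row x ∉ B ∧ col y ∈ B then R x y else 0).rank : ℤ) + δ i) :
    ∃ P'' : Matrix ι ι' K, (∀ x y, ¬ (row x = col y ∧ col y ∈ B) → P'' x y = 0) ∧
      (((Matrix.of fun x y => if row x ∈ B ∧ col y ∈ B then R x y else 0) - P'').rank : ℤ) ≤
        2 * ((Matrix.of fun x y => if row x ∈ B ∧ col y ∉ B then R x y else 0).rank : ℤ) +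
          ((Matrix.of fun x y => if row x ∉ B ∧ col y ∈ B then R x y else 0).rank : ℤ) + ∑ i ∈ B, δ i := by
  classical
  -- names
  set Qm : Matrix ι ι' K := Matrix.of fun x y => if row x ∈ B ∧ col y ∉ B then R x y else 0 with hQm
  set Sm : Matrix ι ι' K := Matrix.of fun x y => if row x ∉ B ∧ col y ∈ B then R x y else 0 with hSm
  set Pm : Matrix ι ι' K := Matrix.of fun x y => if row x ∈ B ∧ col y ∈ B then R x y else 0 with hPm
  -- for each colour `i ∈ B`: the partial blocks and the lift
  set Q' : Q → Matrix ι ι' K := fun i => Matrix.of fun x y => if row x ∈ B.erase i ∧ col y ∉ B then R x y else 0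
    with hQ'
  set P' : Q → Matrix ι ι' K := fun i => Matrix.of fun x y => if row x ∈ B.erase i ∧ col y = i then R x y else 0
    with hP'
  have hlift : ∀ i, i ∈ B → ∃ Z : Matrix ι' ι' K, (P' i - Q' i * Z).rank + (Q' i).rank ≤ (Q' i + P' i).rank := by
    intro i hi
    refine exists_lift (Q' i) (P' i) (fun y => col y ∉ B) (fun x y hy => ?_) (fun x y hy => ?_)
    · simp only [hQ', Matrix.of_apply]; rw [if_neg]; exact fun h => hy h.2
    · simp only [hP', Matrix.of_apply]; rw [if_neg]; rintro ⟨-, h⟩; exact hy (h ▸ hi)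
  choose! Z hZ using hlift
  -- restrict `Z i` to the columns of colour `i`
  set Δ : Q → Matrix ι' ι' K := fun i => Matrix.diagonal fun y => if col y = i then (1 : K) else 0 with hΔ
  set Zf : Q → Matrix ι' ι' K := fun i => Z i * Δ i with hZf
  set E : Q → Matrix ι ι' K := fun i => P' i - Q' i * Zf i with hEd
  -- entrywise facts
  have mulΔ : ∀ (A : Matrix ι ι' K) i x y, (A * Δ i) x y = if col y = i then A x y else 0 := by
    intro A i x y
    simp only [hΔ, Matrix.mul_diagonal]
    split_ifs <;> simp
  have fact1 : ∀ i x y, col y ≠ i → (Qm * Zf i) x y = 0 := by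
    intro i x y h
    simp only [hZf, ← Matrix.mul_assoc, mulΔ, if_neg h]
  have fact2 : ∀ (W : Matrix ι' ι' K) x y, row x ∉ B → (Qm * W) x y = 0 := by
    intro W x y hx
    simp only [Matrix.mul_apply, hQm, Matrix.of_apply]
    exact Finset.sum_eq_zero fun y' _ => by rw [if_neg (fun h => hx h.1), zero_mul]
  have fact3 : ∀ i (W : Matrix ι' ι' K) x y, (Q' i * W) x y = if row x ∈ B.erase i then (Qm * W) x y else 0 := by
    intro i W x y
    simp only [Matrix.mul_apply, hQ', hQm, Matrix.of_apply]
    by_cases hx : row x ∈ B.erase i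
    · rw [if_pos hx]
      refine Finset.sum_congr rfl fun y' _ => ?_
      have hxB : row x ∈ B := (mem_erase.mp hx).2
      by_cases hy' : col y' ∉ B
      · rw [if_pos ⟨hx, hy'⟩, if_pos ⟨hxB, hy'⟩]
      · rw [if_neg (fun h => hy' h.2), if_neg (fun h => hy' h.2)]
    · rw [if_neg hx]
      exact Finset.sum_eq_zero fun y' _ => by rw [if_neg (fun h => hx h.1), zero_mul]
  have hErank : ∀ i ∈ B, (E i).rank ≤ (P' i - Q' i * Z i).rank := by
    intro i hi
    have : E i = (P' i - Q' i * Z i) * Δ i := by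
      ext x y
      simp only [hEd, hZf, Matrix.sub_apply, ← Matrix.mul_assoc, mulΔ]
      by_cases hy : col y = i
      · simp [hy]
      · rw [if_neg hy, if_neg hy, sub_zero]
        simp only [hP', Matrix.of_apply]; rw [if_neg]; rintro ⟨-, h⟩; exact hy h
    rw [this]; exact Matrix.rank_mul_le_left _ _
  -- the `a_i` bound from the slack hypothesis:
  -- rank (P' i − Q' i Z i) ≤ (rank Qm − rank Q' i) + (rank Sm − rank S_{−i}) + δ i
  have ha : ∀ i ∈ B, ((P' i - Q' i * Z i).rank : ℤ) ≤
      ((Qm.rank : ℤ) - (Q' i).rank) +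
      ((Sm.rank : ℤ) - (Matrix.of fun x y => if row x ∉ B ∧ col y ∈ B.erase i then R x y else 0).rank) + δ i := by
    intro i hi
    have h1 := hZ i hi
    have h2' := h i hi
    -- `Q' i + P' i` is the first block of the cut `B.erase i`
    have e1 : Q' i + P' i = Matrix.of fun x y => if row x ∈ B.erase i ∧ col y ∉ B.erase i then R x y else 0 := by
      ext x y
      simp only [hQ', hP', Matrix.add_apply, Matrix.of_apply]
      have hmem : col y ∉ B.erase i ↔ (col y ∉ B ∨ col y = i) := by
        rw [mem_erase, not_and_or, not_not]; tauto
      by_cases hr : row x ∈ B.erase i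
      · by_cases h1 : col y ∈ B
        · by_cases h2 : col y = i
          · rw [if_neg (fun h => h.2 h1), if_pos ⟨hr, h2⟩, if_pos ⟨hr, hmem.mpr (Or.inr h2)⟩, zero_add]
          · rw [if_neg (fun h => h.2 h1), if_neg (fun h => h2 h.2),
              if_neg (fun h => (hmem.mp h.2).elim (fun h' => h' h1) h2), add_zero]
        · have h2 : col y ≠ i := fun h => h1 (h ▸ hi)
          rw [if_pos ⟨hr, h1⟩, if_neg (fun h => h2 h.2), if_pos ⟨hr, hmem.mpr (Or.inl h1)⟩, add_zero]
      · rw [if_neg (fun h => hr h.1), if_neg (fun h => hr h.1), if_neg (fun h => hr h.1), add_zero]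
    -- the second block of the cut `B.erase i` contains `S_{−i}` (zero the rows of colour `i`)
    have e2 : (Matrix.of fun x y => if row x ∉ B ∧ col y ∈ B.erase i then R x y else 0).rank ≤
        (Matrix.of fun x y => if row x ∉ B.erase i ∧ col y ∈ B.erase i then R x y else 0).rank := by
      have : (Matrix.of fun x y => if row x ∉ B ∧ col y ∈ B.erase i then R x y else 0) =
          Matrix.of fun x y => if row x ∉ B then
            (Matrix.of fun x y => if row x ∉ B.erase i ∧ col y ∈ B.erase i then R x y else (0 : K)) x y else 0 := by
        ext x y
        simp only [Matrix.of_apply]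
        by_cases hx : row x ∈ B
        · rw [if_neg (fun h => h.1 hx), if_neg (not_not.mpr hx)]
        · rw [if_pos hx]
          by_cases hy : col y ∈ B.erase i
          · rw [if_pos ⟨hx, hy⟩, if_pos ⟨fun h => hx (mem_erase.mp h).2, hy⟩]
          · rw [if_neg (fun h => hy h.2), if_neg (fun h => hy h.2)]
      rw [this]; exact rank_rowZero_le _ _
    rw [e1] at h1
    have h1' : ((P' i - Q' i * Z i).rank : ℤ) + (Q' i).rank ≤
        (Matrix.of fun x y => if row x ∈ B.erase i ∧ col y ∉ B.erase i then R x y else 0).rank := by exact_mod_cast h1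
    have e2' : ((Matrix.of fun x y => if row x ∉ B ∧ col y ∈ B.erase i then R x y else 0).rank : ℤ) ≤
        (Matrix.of fun x y => if row x ∉ B.erase i ∧ col y ∈ B.erase i then R x y else 0).rank := by exact_mod_cast e2
    linarith
  -- private dimensions: rows of `Qm` by row colour, columns of `Sm` by column colour
  have hq : ∑ i ∈ B, ((Qm.rank : ℤ) - (Q' i).rank) ≤ Qm.rank := by
    have main := sum_rank_sub_erase_le (K := K) row (Matrix.of fun x y => if col y ∉ B then R x y else (0 : K)) B B
    have e0 : ∀ S : Finset Q, (Matrix.of fun z y => if row z ∈ S then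
        (Matrix.of fun x y => if col y ∉ B then R x y else (0 : K)) z y else 0) =
        Matrix.of fun x y => if row x ∈ S ∧ col y ∉ B then R x y else 0 := by
      intro S; ext x y; simp only [Matrix.of_apply]; split_ifs <;> tauto
    simp only [e0, Finset.sdiff_self] at main
    have hz : ((Matrix.of fun x y => if row x ∈ (∅ : Finset Q) ∧ col y ∉ B then R x y else (0 : K)).rank : ℤ) ≥ 0 := by
      positivity
    simpa [hQm, hQ'] using (by linarith : ∑ i ∈ B, (((Matrix.of fun x y => if row x ∈ B ∧ col y ∉ B then R x y else (0:K)).rank : ℤ) -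
        ((Matrix.of fun x y => if row x ∈ B.erase i ∧ col y ∉ B then R x y else (0:K)).rank : ℤ)) ≤
        ((Matrix.of fun x y => if row x ∈ B ∧ col y ∉ B then R x y else (0:K)).rank : ℤ))
  have hs : ∑ i ∈ B, ((Sm.rank : ℤ) - (Matrix.of fun x y => if row x ∉ B ∧ col y ∈ B.erase i then R x y else 0).rank) ≤
      Sm.rank := by
    -- transpose: the column classes of `Sm` are the row classes of `Smᵀ`
    have main := sum_rank_sub_erase_le (K := K) col
      (Matrix.of fun (y : ι') (x : ι) => if row x ∉ B then R x y else (0 : K)) B B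
    have e0 : ∀ S : Finset Q, (Matrix.of fun (z : ι') (x : ι) => if col z ∈ S then
        (Matrix.of fun (y : ι') (x : ι) => if row x ∉ B then R x y else (0 : K)) z x else 0) =
        (Matrix.of fun x y => if row x ∉ B ∧ col y ∈ S then R x y else (0 : K)).transpose := by
      intro S; ext y x; simp only [Matrix.of_apply, Matrix.transpose_apply]; split_ifs <;> tauto
    simp only [e0, Matrix.rank_transpose, Finset.sdiff_self] at main
    have hz : ((Matrix.of fun x y => if row x ∉ B ∧ col y ∈ (∅ : Finset Q) then R x y else (0 : K)).rank : ℤ) ≥ 0 := by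
      positivity
    simpa [hSm] using (by linarith : ∑ i ∈ B, (((Matrix.of fun x y => if row x ∉ B ∧ col y ∈ B then R x y else (0:K)).rank : ℤ) -
        ((Matrix.of fun x y => if row x ∉ B ∧ col y ∈ B.erase i then R x y else (0:K)).rank : ℤ)) ≤
        ((Matrix.of fun x y => if row x ∉ B ∧ col y ∈ B then R x y else (0:K)).rank : ℤ))
  have hsumE : (∑ i ∈ B, ((E i).rank : ℤ)) ≤ (Qm.rank : ℤ) + Sm.rank + ∑ i ∈ B, δ i := by
    have : ∀ i ∈ B, ((E i).rank : ℤ) ≤ ((Qm.rank : ℤ) - (Q' i).rank) +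
        ((Sm.rank : ℤ) - (Matrix.of fun x y => if row x ∉ B ∧ col y ∈ B.erase i then R x y else 0).rank) + δ i :=
      fun i hi => le_trans (by exact_mod_cast hErank i hi) (ha i hi)
    calc (∑ i ∈ B, ((E i).rank : ℤ)) ≤ ∑ i ∈ B, (((Qm.rank : ℤ) - (Q' i).rank) +
        ((Sm.rank : ℤ) - (Matrix.of fun x y => if row x ∉ B ∧ col y ∈ B.erase i then R x y else 0).rank) + δ i) :=
          Finset.sum_le_sum this
      _ ≤ (Qm.rank : ℤ) + Sm.rank + ∑ i ∈ B, δ i := by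
          rw [Finset.sum_add_distrib, Finset.sum_add_distrib]; linarith
  -- the colour-block-diagonal approximant
  set P'' : Matrix ι ι' K := Matrix.of fun x y =>
    if row x = col y ∧ col y ∈ B then R x y - (Qm * Zf (col y)) x y else 0 with hP''
  refine ⟨P'', fun x y hxy => by simp only [hP'', Matrix.of_apply, if_neg hxy], ?_⟩
  have hdec : Pm - P'' = Qm * (∑ i ∈ B, Zf i) + ∑ i ∈ B, E i := by
    ext x y
    have s1 : (Qm * ∑ i ∈ B, Zf i) x y = if col y ∈ B then (Qm * Zf (col y)) x y else 0 := by
      rw [Matrix.mul_sum, Matrix.sum_apply]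
      by_cases hyB : col y ∈ B
      · rw [if_pos hyB, Finset.sum_eq_single_of_mem (col y) hyB (fun i _ hi => fact1 i x y (Ne.symm hi))]
      · rw [if_neg hyB]; exact Finset.sum_eq_zero (fun i hi => fact1 i x y (fun h => hyB (h ▸ hi)))
    have s2 : ∀ i, E i x y = (if row x ∈ B.erase i ∧ col y = i then R x y else 0) -
        (if row x ∈ B.erase i then (Qm * Zf i) x y else 0) := by
      intro i; simp only [hEd, Matrix.sub_apply, hP', Matrix.of_apply, fact3]
    have s2' : ∀ i, col y ≠ i → E i x y = 0 := by
      intro i hne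
      rw [s2, fact1 i x y hne, if_neg (show ¬ (row x ∈ B.erase i ∧ col y = i) from fun h => hne h.2)]
      split_ifs <;> simp
    have s3 : (∑ i ∈ B, E i) x y = if col y ∈ B then E (col y) x y else 0 := by
      rw [Matrix.sum_apply]
      by_cases hyB : col y ∈ B
      · rw [if_pos hyB, Finset.sum_eq_single_of_mem (col y) hyB (fun i _ hi => s2' i (Ne.symm hi))]
      · rw [if_neg hyB]; exact Finset.sum_eq_zero (fun i hi => s2' i (fun h => hyB (h ▸ hi)))
    rw [Matrix.add_apply, s1, s3, Matrix.sub_apply]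
    by_cases hyB : col y ∈ B
    · rw [if_pos hyB, if_pos hyB, s2]
      by_cases hxB : row x ∈ B
      · by_cases hxi : row x = col y
        · have hne : row x ∉ B.erase (col y) := by simp [hxi]
          have vPm : Pm x y = R x y := by simp [hPm, hxB, hyB]
          have vP : P'' x y = R x y - (Qm * Zf (col y)) x y := by simp [hP'', hxi, hyB]
          have v3 : (if row x ∈ B.erase (col y) ∧ col y = col y then R x y else 0) = 0 := by simp [hne]
          have v4 : (if row x ∈ B.erase (col y) then (Qm * Zf (col y)) x y else 0) = 0 := by simp [hne]
          rw [vPm, vP, v3, v4]; ring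
        · have hmem : row x ∈ B.erase (col y) := mem_erase.mpr ⟨hxi, hxB⟩
          have vPm : Pm x y = R x y := by simp [hPm, hxB, hyB]
          have vP : P'' x y = 0 := by simp [hP'', hxi]
          have v3 : (if row x ∈ B.erase (col y) ∧ col y = col y then R x y else 0) = R x y := by simp [hmem]
          have v4 : (if row x ∈ B.erase (col y) then (Qm * Zf (col y)) x y else 0) = (Qm * Zf (col y)) x y := by
            simp [hmem]
          rw [vPm, vP, v3, v4]; ring
      · have hne : row x ∉ B.erase (col y) := fun h => hxB (mem_erase.mp h).2
        have hne' : ¬ (row x = col y ∧ col y ∈ B) := fun h => hxB (h.1 ▸ hyB)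
        have vPm : Pm x y = 0 := by simp [hPm, hxB]
        have vP : P'' x y = 0 := by simp [hP'', hne']
        have v3 : (if row x ∈ B.erase (col y) ∧ col y = col y then R x y else 0) = 0 := by simp [hne]
        have v4 : (if row x ∈ B.erase (col y) then (Qm * Zf (col y)) x y else 0) = 0 := by simp [hne]
        rw [vPm, vP, v3, v4, fact2 _ x y hxB]; ring
    · rw [if_neg hyB, if_neg hyB]
      have vPm : Pm x y = 0 := by simp [hPm, hyB]
      have vP : P'' x y = 0 := by simp [hP'', hyB]
      rw [vPm, vP]; ring
  rw [hdec]
  have r1 := Matrix.rank_mul_le_left Qm (∑ i ∈ B, Zf i)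
  have r2 := rank_finsetSum_le B E
  have r3 := rank_add_le (Qm * ∑ i ∈ B, Zf i) (∑ i ∈ B, E i)
  have r2' : ((∑ i ∈ B, E i).rank : ℤ) ≤ ∑ i ∈ B, ((E i).rank : ℤ) := by exact_mod_cast r2
  have r1' : ((Qm * ∑ i ∈ B, Zf i).rank : ℤ) ≤ Qm.rank := by exact_mod_cast r1
  have r3' : ((Qm * ∑ i ∈ B, Zf i + ∑ i ∈ B, E i).rank : ℤ) ≤
      (Qm * ∑ i ∈ B, Zf i).rank + (∑ i ∈ B, E i).rank := by exact_mod_cast r3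
  linarith

/-- **TOOL stub W11 `stub_oneSidedSlack` (lead g16 RESHAPE 13), the registered signature verbatim: the ONE-SIDED DECOMPOSITION WITH
SIGNED SLACK.**  For every field `K`, colourings `row, col` by a type `Q` of colours, matrix `R`, colour set `B` and slack function
`δ : Q → ℤ` with `μ(B ∖ i) ≤ μ(B) + δ i` for all `i ∈ B` (`μ` the bipartition cut), the diagonal super-block `R|_{(row∈B)×(col∈B)}`
is within rank `2·rank R|_{(row∈B)×(col∉B)} + rank R|_{(row∉B)×(col∈B)} + Σ_{i∈B} δ i` of a matrix supported on `{row = col ∈ B}`.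
Immediate from `oneSided_decomposition_slack`. -/
theorem stub_oneSidedSlack :
    ∀ (K : Type) [Field K] (ι ι' Q : Type) [Fintype ι] [Fintype ι'] [DecidableEq ι] [DecidableEq ι'] [DecidableEq Q]
      (row : ι → Q) (col : ι' → Q) (R : Matrix ι ι' K) (B : Finset Q) (δ : Q → ℤ),
      (∀ i ∈ B,
        (((Matrix.of fun x y => if row x ∈ B.erase i ∧ col y ∉ B.erase i then R x y else 0).rank : ℤ) +
          ((Matrix.of fun x y => if row x ∉ B.erase i ∧ col y ∈ B.erase i then R x y else 0).rank : ℤ)) ≤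
        ((Matrix.of fun x y => if row x ∈ B ∧ col y ∉ B then R x y else 0).rank : ℤ) +
          ((Matrix.of fun x y => if row x ∉ B ∧ col y ∈ B then R x y else 0).rank : ℤ) + δ i) →
      ∃ P'' : Matrix ι ι' K, (∀ x y, ¬ (row x = col y ∧ col y ∈ B) → P'' x y = 0) ∧
        (((Matrix.of fun x y => if row x ∈ B ∧ col y ∈ B then R x y else 0) - P'').rank : ℤ) ≤
          2 * ((Matrix.of fun x y => if row x ∈ B ∧ col y ∉ B then R x y else 0).rank : ℤ) +
            ((Matrix.of fun x y => if row x ∉ B ∧ col y ∈ B then R x y else 0).rank : ℤ) + ∑ i ∈ B, δ i := by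
  intro K _ ι ι' Q _ _ _ _ _ row col R B δ h
  exact oneSided_decomposition_slack row col R B δ h

end Summit.PneNP.PneNP.Theorems.CnfIdealGenLengthRankDefectRepresentationsOneSidedSlack
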